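import Literature.Probability.LatticeModels.ClusterExpansion
import HarnessLib

/-!
# BalabanIR crux 2R `BirComplexStableXYR` (stmt-HubbardSuperconductivity-14845): positivity of a polymer partition
# function from a conjugating symmetry — the conjunct-1 endgame of every convergent expansion, for every `r`

Support file for line `fat-gaussian-defect-calculus` (lead c6), stub S5 `stub_singleRegimeRG`, part T-end.

The first conjunct of the crux (`0 < Re Z`, see `Theorems.stub_splitGlueR3`) is, for windows of temporal range
`r ≥ 3`, NOT a consequence of any Hermitian structure: the pair-slice transfer operator is only `J`-self-adjoint
(`T* = J T J`), its spectrum is closed under conjugation but a dominant complex pair is not excluded by symmetry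
(`Cruxes/BirComplexStableXYR/NOTES.md`, lead c5; Disproof §4b.3).  What symmetry DOES give is recorded here, at the
level of the tree's abstract polymer gas (`Literature.Probability.LatticeModels.PolymerGas` / `ClusterExpansion`):

* `polymerPartitionFunction_conj` — `conj Ξ(Λ; w) = Ξ(Λ; conj ∘ w)`.
* `polymerPartitionFunction_conj_eq_self_of_symm` — if a relabeling `σ` of the volume `Λ` (injective on `Λ`,
  `σ(Λ) = Λ`) preserves incompatibility and CONJUGATES the activities, `w (σ γ) = conj (w γ)`, then `Ξ(Λ; w)` is real.
* `polymerPartitionFunction_re_pos_of_symm` — if moreover `Ξ(Λ; t • w) ≠ 0` along the segment `t ∈ [0,1]`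
  (zero-freeness, e.g. Kotecký–Preiss), then `0 < Re Ξ(Λ; w)` and `Im Ξ(Λ; w) = 0`: the whole segment consists of
  real non-zero values of a continuous function equal to `1` at `t = 0` (intermediate value theorem) — no logarithm,
  no cluster expansion needed.
* `polymerPartitionFunction_re_pos_of_kp_of_symm` — the Kotecký–Preiss form: a KP volume with a conjugating
  symmetry has a real, strictly positive partition function.

Use toward the crux (all `r ≥ 2`).  In any convergent polymer representation `Z = Z_ref · Ξ(Λ; w)` of the engine's
partition function — single-scale where it converges, or the last step of the multiscale expansion T-RG — the
space-time inversion `I` (time reflection (R) composed with the spatial inversion (P) and a translation) maps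
polymers to polymers, preserves overlap-incompatibility, leaves the real Gaussian reference invariant and conjugates
the perturbation (`A ∘ I = conj A`, the (R)∧(P) reality of the quadratic part is `Theorems…GaussianReality`), hence
conjugates every activity: `w (I X) = conj (w X)`.  The theorems below then give `Ξ > 0`, i.e. conjunct 1, with no
spectral input — this is the precise sense in which "`0 < Re Z` for every `r` comes out of the convergent
representation, `E` real" (line card §S5, T-end).  What they do not give is the convergence itself (T-RG).
[folklore]
-/

set_option linter.dupNamespace false -- summit = problem name (single-conjunct summit), D-0017

noncomputable section

namespace Summit.HubbardSuperconductivity.HubbardSuperconductivity.Theorems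

open scoped BigOperators ComplexConjugate
open Literature.Probability.LatticeModels

variable {P : Type*} [DecidableEq P] {inc : P → P → Prop} [DecidableRel inc]

/-- **Conjugation of the activities conjugates the polymer partition function**:
`conj Ξ(Λ; w) = Ξ(Λ; conj ∘ w)` (`conj` is a ring homomorphism). [folklore] -/
theorem polymerPartitionFunction_conj (w : P → ℂ) (Λ : Finset P) :
    conj (polymerPartitionFunction inc w Λ) = polymerPartitionFunction inc (fun γ => conj (w γ)) Λ := by
  unfold polymerPartitionFunction
  rw [map_sum]
  refine Finset.sum_congr rfl fun A _ => ?_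
  split_ifs
  · rw [map_prod]
  · rw [map_zero]

/-- **A conjugating symmetry makes the partition function real.**  If `σ` is injective on the volume `Λ`, maps
`Λ` onto itself, preserves incompatibility on `Λ` and conjugates the activities (`w (σ γ) = conj (w γ)` on `Λ`), then
`conj Ξ(Λ; w) = Ξ(Λ; w)` (relabeling invariance `polymerPartitionFunction_image` applied to `σ`). [folklore] -/
theorem polymerPartitionFunction_conj_eq_self_of_symm {w : P → ℂ} {Λ : Finset P} {σ : P → P}
    (hσ : Set.InjOn σ Λ) (hσΛ : Λ.image σ = Λ)
    (hR : ∀ a ∈ Λ, ∀ b ∈ Λ, (inc (σ a) (σ b) ↔ inc a b)) (hw : ∀ a ∈ Λ, w (σ a) = conj (w a)) :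
    conj (polymerPartitionFunction inc w Λ) = polymerPartitionFunction inc w Λ := by
  rw [polymerPartitionFunction_conj]
  have h := polymerPartitionFunction_image (inc := inc) (inc' := inc) (w := fun γ => conj (w γ)) (w' := w)
    (Λ := Λ) hσ hR hw
  rw [hσΛ] at h
  exact h.symm

/-- Along the real ray `t • w` a conjugating symmetry of `w` is a conjugating symmetry of `t • w`, so every
`Ξ(Λ; t • w)` is real. [folklore] -/
theorem polymerPartitionFunction_ray_im_eq_zero_of_symm {w : P → ℂ} {Λ : Finset P} {σ : P → P}
    (hσ : Set.InjOn σ Λ) (hσΛ : Λ.image σ = Λ)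
    (hR : ∀ a ∈ Λ, ∀ b ∈ Λ, (inc (σ a) (σ b) ↔ inc a b)) (hw : ∀ a ∈ Λ, w (σ a) = conj (w a)) (t : ℝ) :
    (polymerPartitionFunction inc (fun γ => (t : ℂ) * w γ) Λ).im = 0 := by
  have hw' : ∀ a ∈ Λ, (fun γ => (t : ℂ) * w γ) (σ a) = conj ((fun γ => (t : ℂ) * w γ) a) := by
    intro a ha
    simp only [map_mul, Complex.conj_ofReal, hw a ha]
  exact Complex.conj_eq_iff_im.1 (polymerPartitionFunction_conj_eq_self_of_symm hσ hσΛ hR hw')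

/-- **Positivity from a conjugating symmetry and zero-freeness.**  If `σ` is a conjugating symmetry of the
activities on the volume `Λ` (as in `polymerPartitionFunction_conj_eq_self_of_symm`) and the partition function
does not vanish along the segment `t • w`, `t ∈ [0,1]`, then `Ξ(Λ; w)` is real and STRICTLY POSITIVE: the
continuous real function `t ↦ Ξ(Λ; t • w)` equals `1` at `t = 0` and has no zero on `[0,1]` (intermediate value
theorem). [folklore] -/
theorem polymerPartitionFunction_re_pos_of_symm {w : P → ℂ} {Λ : Finset P} {σ : P → P}
    (hσ : Set.InjOn σ Λ) (hσΛ : Λ.image σ = Λ)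
    (hR : ∀ a ∈ Λ, ∀ b ∈ Λ, (inc (σ a) (σ b) ↔ inc a b)) (hw : ∀ a ∈ Λ, w (σ a) = conj (w a))
    (hZ : ∀ t ∈ Set.Icc (0 : ℝ) 1, polymerPartitionFunction inc (fun γ => (t : ℂ) * w γ) Λ ≠ 0) :
    0 < (polymerPartitionFunction inc w Λ).re ∧ (polymerPartitionFunction inc w Λ).im = 0 := by
  have hreal := polymerPartitionFunction_ray_im_eq_zero_of_symm (inc := inc) hσ hσΛ hR hw
  set g : ℝ → ℝ := fun t => (polymerPartitionFunction inc (fun γ => (t : ℂ) * w γ) Λ).re with hg_def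
  have hg : Continuous g := Complex.continuous_re.comp (continuous_polymerPartitionFunction_ray w Λ)
  have hg0 : g 0 = 1 := by
    simp only [hg_def, Complex.ofReal_zero]
    rw [polymerPartitionFunction_zero_mul w Λ, Complex.one_re]
  have hZ1 : polymerPartitionFunction inc (fun γ => ((1 : ℝ) : ℂ) * w γ) Λ = polymerPartitionFunction inc w Λ := by
    simp only [Complex.ofReal_one, one_mul]
  have hg1 : g 1 = (polymerPartitionFunction inc w Λ).re := by
    simp only [hg_def, hZ1]
  have hgne : ∀ t ∈ Set.Icc (0 : ℝ) 1, g t ≠ 0 := by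
    intro t ht hgt
    apply hZ t ht
    apply Complex.ext
    · rw [Complex.zero_re]; exact hgt
    · rw [Complex.zero_im]; exact hreal t
  refine ⟨?_, by simpa only [hZ1] using hreal 1⟩
  by_contra hle
  rw [not_lt] at hle
  have hmem : (0 : ℝ) ∈ Set.Icc (g 1) (g 0) := ⟨by rw [hg1]; exact hle, by rw [hg0]; exact zero_le_one⟩
  obtain ⟨t, ht, hgt⟩ := intermediate_value_Icc' zero_le_one hg.continuousOn hmem
  exact hgne t ht hgt

/-- **Kotecký–Preiss form.**  On a KP volume (`IsKPVolume`, [KP86, (1)]) whose activities admit a conjugating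
symmetry, the polymer partition function is real and strictly positive (the segment `t • w`, `t ∈ [0,1]`, stays KP,
hence zero-free by `polymerPartitionFunction_ne_zero_of_kp`). [folklore] -/
theorem polymerPartitionFunction_re_pos_of_kp_of_symm [Std.Refl inc] [Std.Symm inc] {w : P → ℂ} {a : P → ℝ}
    {Λ : Finset P} {σ : P → P} (hKP : IsKPVolume inc w a Λ)
    (hσ : Set.InjOn σ Λ) (hσΛ : Λ.image σ = Λ)
    (hR : ∀ a ∈ Λ, ∀ b ∈ Λ, (inc (σ a) (σ b) ↔ inc a b)) (hw : ∀ a ∈ Λ, w (σ a) = conj (w a)) :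
    0 < (polymerPartitionFunction inc w Λ).re ∧ (polymerPartitionFunction inc w Λ).im = 0 := by
  refine polymerPartitionFunction_re_pos_of_symm hσ hσΛ hR hw fun t ht => ?_
  have hKPt : IsKPVolume inc (fun γ => (t : ℂ) * w γ) a Λ := fun γ hγ => by
    refine le_trans (Finset.sum_le_sum fun γ' _ => ?_) (hKP γ hγ)
    unfold kpTerm
    refine mul_le_mul_of_nonneg_right ?_ (Real.exp_nonneg _)
    rw [norm_mul, Complex.norm_real, Real.norm_eq_abs, abs_of_nonneg ht.1]
    exact mul_le_of_le_one_left (norm_nonneg _) ht.2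
  exact polymerPartitionFunction_ne_zero_of_kp hKPt subset_rfl


/-- **Registered sub-goal `conjPositivity_endgame` (crux stmt-HubbardSuperconductivity-14845, S5 part T-end): a
polymer partition function with a conjugating symmetry that is zero-free along its activity ray is real and strictly
positive.**  Binder form of `polymerPartitionFunction_re_pos_of_symm`. [folklore] -/
theorem conjPositivity_endgame : ∀ {P : Type*} [DecidableEq P] (inc : P → P → Prop) [DecidableRel inc] (w : P → ℂ) (Λ : Finset P) (σ : P → P), Set.InjOn σ Λ → Λ.image σ = Λ → (∀ a ∈ Λ, ∀ b ∈ Λ, (inc (σ a) (σ b) ↔ inc a b)) → (∀ a ∈ Λ, w (σ a) = (starRingEnd ℂ) (w a)) → (∀ t ∈ Set.Icc (0 : ℝ) 1, Literature.Probability.LatticeModels.polymerPartitionFunction inc (fun γ => (t : ℂ) * w γ) Λ ≠ 0) → 0 < (Literature.Probability.LatticeModels.polymerPartitionFunction inc w Λ).re ∧ (Literature.Probability.LatticeModels.polymerPartitionFunction inc w Λ).im = 0 :=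
  fun inc _ _ _ _ hσ hσΛ hR hw hZ => polymerPartitionFunction_re_pos_of_symm (inc := inc) hσ hσΛ hR hw hZ

end Summit.HubbardSuperconductivity.HubbardSuperconductivity.Theorems

end
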